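import Summits.KontsevichZagierPeriods.KontsevichZagierPeriods.Theorems.RootDecompRationalCubeDichotomyRankDescentP12

/-! # `RootDecompRationalCubeDichotomyRankDescentP13` — part 13/14 of the mechanical ≤400-line split of `RankDescent_v12_landing.lean` (sha256 00885b8b9882f02e…)
Source: decomp-kz lens-2 g13 `RankDescent_v12.lean` (HOME/decomp-kz-lens-2/g13/, sha256 00885b8b…; critic g5-18…g5-66 CLEARED as NODE v1–v12 for crux stmt-KontsevichZagierPeriods-26322 RationalCubePiKernelSingle: rank dichotomy single_of_fullRankGeTwo + RankLeOneKernel, de Rham-exact descent, linear-in-one-variable / hyperbola / Fermat–hyperbolic / conic classes, transport kit, Brieskorn module; writer g7 l.1222: «landing split §0–4 ∣ … ∣ §16 --supports 26322 endorsed»); `#print axioms` pins removed; landed by census-1 g9.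
Split by census-1 g9 `gen/splitlean.py`: scopes re-opened with their `open`/`variable`/`set_option` context; mathematics and declaration order unchanged. -/

noncomputable section
open MeasureTheory Set MvPolynomial
open Literature.NumberTheory.Transcendental
open Literature.NumberTheory.Transcendental.KZ
namespace Summit.KontsevichZagierPeriods.RootDecompRationalCubeDichotomy.Rung26322.RankDescent
variable {M : ℕ}

/-- Auxiliary step `boxY_mem`: box Y mem. [bookkeeping] -/
theorem boxY_mem (c α β : ℚ) (hβ : β ≠ 0) (p q i : ℕ) :
    (X 0 ^ i * X 1 ^ q : MvPolynomial (Fin 2) ℚ) ∈ Ex0 (bpQ c α β p q) := by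
  have hc : ((i : ℚ) + 1) * (((q : ℚ) + 1) * β) ≠ 0 := mul_ne_zero (by positivity) (mul_ne_zero (by positivity) hβ)
  refine (Submodule.smul_mem_iff _ hc).mp ?_
  rw [smul_eq_C_mul]
  exact hopBPY_mem c α β p q i

/-- x-descent factor after `a` steps of `p+1`, landing on `x^{i₀} y^j`. [folklore] -/
def kx (c α : ℚ) (p q i₀ j : ℕ) : ℕ → ℚ
  | 0 => 1
  | (a + 1) => -((((((p + 1) * a + i₀ : ℕ) : ℚ) + 1) * ((q : ℚ) + 1) * c) / (α * bpS p q ((p + 1) * a + i₀) j))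
      * kx c α p q i₀ j a

/-- y-descent factor after `b` steps of `q+1`, landing on `x^{i₀} y^{j₀}`. [folklore] -/
def ky (c β : ℚ) (p q i₀ j₀ : ℕ) : ℕ → ℚ
  | 0 => 1
  | (b + 1) => -((((((q + 1) * b + j₀ : ℕ) : ℚ) + 1) * ((p : ℚ) + 1) * c) / (β * bpS p q i₀ ((q + 1) * b + j₀)))
      * ky c β p q i₀ j₀ b

/-- Auxiliary step `kx_zero`: kx zero. [bookkeeping] -/
theorem kx_zero (c α : ℚ) (p q i₀ j : ℕ) : kx c α p q i₀ j 0 = 1 := rfl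
/-- Auxiliary step `kx_succ`: kx succ. [bookkeeping] -/
theorem kx_succ (c α : ℚ) (p q i₀ j a : ℕ) : kx c α p q i₀ j (a + 1)
    = -((((((p + 1) * a + i₀ : ℕ) : ℚ) + 1) * ((q : ℚ) + 1) * c) / (α * bpS p q ((p + 1) * a + i₀) j))
      * kx c α p q i₀ j a := rfl
/-- Auxiliary step `ky_zero`: ky zero. [bookkeeping] -/
theorem ky_zero (c β : ℚ) (p q i₀ j₀ : ℕ) : ky c β p q i₀ j₀ 0 = 1 := rfl
/-- Auxiliary step `ky_succ`: ky succ. [bookkeeping] -/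
theorem ky_succ (c β : ℚ) (p q i₀ j₀ b : ℕ) : ky c β p q i₀ j₀ (b + 1)
    = -((((((q + 1) * b + j₀ : ℕ) : ℚ) + 1) * ((p : ℚ) + 1) * c) / (β * bpS p q i₀ ((q + 1) * b + j₀)))
      * ky c β p q i₀ j₀ b := rfl

/-- **x-DESCENT**: `x^{(p+1)a + i₀} y^j − kx(a)·x^{i₀} y^j ∈ Ex0` (`α ≠ 0`). [folklore] -/
theorem descX_pow_mem (c α β : ℚ) (hα : α ≠ 0) (p q i₀ j : ℕ) :
    ∀ a : ℕ, (X 0 ^ ((p + 1) * a + i₀) * X 1 ^ j - C (kx c α p q i₀ j a) * (X 0 ^ i₀ * X 1 ^ j)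
      : MvPolynomial (Fin 2) ℚ) ∈ Ex0 (bpQ c α β p q) := by
  intro a
  induction a with
  | zero => rw [kx_zero, mul_zero, zero_add, C_1, one_mul, sub_self]; exact zero_mem _
  | succ a ih =>
    set i := (p + 1) * a + i₀ with hi
    have hS : α * bpS p q i j ≠ 0 := mul_ne_zero hα (bpS_ne p q i j)
    refine (Submodule.smul_mem_iff _ hS).mp ?_
    have h1 := descX_mem c α β p q i j
    have he : i + p + 1 = (p + 1) * (a + 1) + i₀ := by rw [hi]; ring
    rw [he] at h1
    have hinv : (α * bpS p q i j) * (α * bpS p q i j)⁻¹ = 1 := mul_inv_cancel₀ hS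
    have hk : (α * bpS p q i j) * kx c α p q i₀ j (a + 1) = -((((i : ℕ) : ℚ) + 1) * ((q : ℚ) + 1) * c) * kx c α p q i₀ j a := by
      rw [kx_succ, ← hi, div_eq_mul_inv]
      linear_combination (-((((i : ℕ) : ℚ) + 1) * ((q : ℚ) + 1) * c) * kx c α p q i₀ j a) * hinv
    have hk' : (C (α * bpS p q i j) * C (kx c α p q i₀ j (a + 1)) : MvPolynomial (Fin 2) ℚ)
        = -(C ((((i : ℕ) : ℚ) + 1) * ((q : ℚ) + 1) * c) * C (kx c α p q i₀ j a)) := by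
      rw [← map_mul, hk, neg_mul, map_neg, map_mul]
    have key : ((α * bpS p q i j) • (X 0 ^ ((p + 1) * (a + 1) + i₀) * X 1 ^ j
          - C (kx c α p q i₀ j (a + 1)) * (X 0 ^ i₀ * X 1 ^ j)) : MvPolynomial (Fin 2) ℚ)
        = (C (α * bpS p q i j) * (X 0 ^ ((p + 1) * (a + 1) + i₀) * X 1 ^ j)
            + C ((((i : ℕ) : ℚ) + 1) * ((q : ℚ) + 1) * c) * (X 0 ^ i * X 1 ^ j))
          - ((((i : ℕ) : ℚ) + 1) * ((q : ℚ) + 1) * c) • (X 0 ^ i * X 1 ^ j - C (kx c α p q i₀ j a) * (X 0 ^ i₀ * X 1 ^ j)) := by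
      rw [smul_eq_C_mul, smul_eq_C_mul]
      linear_combination (-(X 0 ^ i₀ * X 1 ^ j)) * hk'
    rw [key]
    exact sub_mem h1 (Submodule.smul_mem _ _ ih)

/-- **y-DESCENT**: `x^{i₀} y^{(q+1)b + j₀} − ky(b)·x^{i₀} y^{j₀} ∈ Ex0` (`β ≠ 0`). [folklore] -/
theorem descY_pow_mem (c α β : ℚ) (hβ : β ≠ 0) (p q i₀ j₀ : ℕ) :
    ∀ b : ℕ, (X 0 ^ i₀ * X 1 ^ ((q + 1) * b + j₀) - C (ky c β p q i₀ j₀ b) * (X 0 ^ i₀ * X 1 ^ j₀)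
      : MvPolynomial (Fin 2) ℚ) ∈ Ex0 (bpQ c α β p q) := by
  intro b
  induction b with
  | zero => rw [ky_zero, mul_zero, zero_add, C_1, one_mul, sub_self]; exact zero_mem _
  | succ b ih =>
    set j := (q + 1) * b + j₀ with hj
    have hS : β * bpS p q i₀ j ≠ 0 := mul_ne_zero hβ (bpS_ne p q i₀ j)
    refine (Submodule.smul_mem_iff _ hS).mp ?_
    have h1 := descY_mem c α β p q i₀ j
    have he : j + q + 1 = (q + 1) * (b + 1) + j₀ := by rw [hj]; ring
    rw [he] at h1
    have hinv : (β * bpS p q i₀ j) * (β * bpS p q i₀ j)⁻¹ = 1 := mul_inv_cancel₀ hS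
    have hk : (β * bpS p q i₀ j) * ky c β p q i₀ j₀ (b + 1) = -((((j : ℕ) : ℚ) + 1) * ((p : ℚ) + 1) * c) * ky c β p q i₀ j₀ b := by
      rw [ky_succ, ← hj, div_eq_mul_inv]
      linear_combination (-((((j : ℕ) : ℚ) + 1) * ((p : ℚ) + 1) * c) * ky c β p q i₀ j₀ b) * hinv
    have hk' : (C (β * bpS p q i₀ j) * C (ky c β p q i₀ j₀ (b + 1)) : MvPolynomial (Fin 2) ℚ)
        = -(C ((((j : ℕ) : ℚ) + 1) * ((p : ℚ) + 1) * c) * C (ky c β p q i₀ j₀ b)) := by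
      rw [← map_mul, hk, neg_mul, map_neg, map_mul]
    have key : ((β * bpS p q i₀ j) • (X 0 ^ i₀ * X 1 ^ ((q + 1) * (b + 1) + j₀)
          - C (ky c β p q i₀ j₀ (b + 1)) * (X 0 ^ i₀ * X 1 ^ j₀)) : MvPolynomial (Fin 2) ℚ)
        = (C (β * bpS p q i₀ j) * (X 0 ^ i₀ * X 1 ^ ((q + 1) * (b + 1) + j₀))
            + C ((((j : ℕ) : ℚ) + 1) * ((p : ℚ) + 1) * c) * (X 0 ^ i₀ * X 1 ^ j))
          - ((((j : ℕ) : ℚ) + 1) * ((p : ℚ) + 1) * c) • (X 0 ^ i₀ * X 1 ^ j - C (ky c β p q i₀ j₀ b) * (X 0 ^ i₀ * X 1 ^ j₀)) := by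
      rw [smul_eq_C_mul, smul_eq_C_mul]
      linear_combination (-(X 0 ^ i₀ * X 1 ^ j₀)) * hk'
    rw [key]
    exact sub_mem h1 (Submodule.smul_mem _ _ ih)

/-- The coefficient of the reduction of `x^i y^j` onto its box monomial `x^{i mod (p+1)} y^{j mod (q+1)}`. [folklore] -/
def bpK (c α β : ℚ) (p q i j : ℕ) : ℚ :=
  kx c α p q (i % (p + 1)) j (i / (p + 1)) * ky c β p q (i % (p + 1)) (j % (q + 1)) (j / (q + 1))

/-- **Every monomial is congruent to a rational multiple of ONE box monomial**: `x^i y^j − bpK·x^{i mod (p+1)} y^{j mod (q+1)} ∈ Ex0`. [folklore] -/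
theorem bpMon_sub_C_mul_mem (c α β : ℚ) (hα : α ≠ 0) (hβ : β ≠ 0) (p q i j : ℕ) :
    (X 0 ^ i * X 1 ^ j - C (bpK c α β p q i j) * (X 0 ^ (i % (p + 1)) * X 1 ^ (j % (q + 1)))
      : MvPolynomial (Fin 2) ℚ) ∈ Ex0 (bpQ c α β p q) := by
  have h1 := descX_pow_mem c α β hα p q (i % (p + 1)) j (i / (p + 1))
  rw [Nat.div_add_mod] at h1
  have h2 := descY_pow_mem c α β hβ p q (i % (p + 1)) (j % (q + 1)) (j / (q + 1))
  rw [Nat.div_add_mod] at h2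
  have key : (X 0 ^ i * X 1 ^ j - C (bpK c α β p q i j) * (X 0 ^ (i % (p + 1)) * X 1 ^ (j % (q + 1)))
      : MvPolynomial (Fin 2) ℚ)
      = (X 0 ^ i * X 1 ^ j - C (kx c α p q (i % (p + 1)) j (i / (p + 1))) * (X 0 ^ (i % (p + 1)) * X 1 ^ j))
        + (kx c α p q (i % (p + 1)) j (i / (p + 1))) • (X 0 ^ (i % (p + 1)) * X 1 ^ j
            - C (ky c β p q (i % (p + 1)) (j % (q + 1)) (j / (q + 1))) * (X 0 ^ (i % (p + 1)) * X 1 ^ (j % (q + 1)))) := by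
    rw [smul_eq_C_mul, bpK, map_mul]
    ring
  rw [key]
  exact add_mem h1 (Submodule.smul_mem _ _ h2)

/-- The reduction of the monomial `x^i y^j`: zero on the box edges, else `bpK · x^{i₀} y^{j₀}` with `i₀ < p`, `j₀ < q`. [folklore] -/
def bpMonRed (c α β : ℚ) (p q i j : ℕ) : MvPolynomial (Fin 2) ℚ :=
  if i % (p + 1) = p ∨ j % (q + 1) = q then 0
  else C (bpK c α β p q i j) * (X 0 ^ (i % (p + 1)) * X 1 ^ (j % (q + 1)))

/-- Auxiliary step `bpMon_sub_red_mem`: bp Mon sub red mem. [bookkeeping] -/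
theorem bpMon_sub_red_mem (c α β : ℚ) (hα : α ≠ 0) (hβ : β ≠ 0) (p q i j : ℕ) :
    (X 0 ^ i * X 1 ^ j - bpMonRed c α β p q i j : MvPolynomial (Fin 2) ℚ) ∈ Ex0 (bpQ c α β p q) := by
  have h := bpMon_sub_C_mul_mem c α β hα hβ p q i j
  unfold bpMonRed
  split_ifs with hbox
  · rw [sub_zero]
    have hb : (X 0 ^ (i % (p + 1)) * X 1 ^ (j % (q + 1)) : MvPolynomial (Fin 2) ℚ) ∈ Ex0 (bpQ c α β p q) := by
      rcases hbox with hx | hy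
      · rw [hx]; exact boxX_mem c α β hα p q _
      · rw [hy]; exact boxY_mem c α β hβ p q _
    have := add_mem h (Submodule.smul_mem _ (bpK c α β p q i j) hb)
    rwa [smul_eq_C_mul, sub_add_cancel] at this
  · exact h

/-- Auxiliary step `coeff_bpMonRed_eq_zero`: coeff bp Mon Red eq zero. [bookkeeping] -/
theorem coeff_bpMonRed_eq_zero (c α β : ℚ) (p q i j : ℕ) (d : Fin 2 →₀ ℕ) (hd : p ≤ d 0 ∨ q ≤ d 1) :
    coeff d (bpMonRed c α β p q i j) = 0 := by
  unfold bpMonRed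
  split_ifs with hbox
  · exact coeff_zero _
  · obtain ⟨hx, hy⟩ := not_or.mp hbox
    have hi : i % (p + 1) < p := lt_of_le_of_ne (Nat.le_of_lt_succ (Nat.mod_lt _ (Nat.succ_pos p))) hx
    have hj : j % (q + 1) < q := lt_of_le_of_ne (Nat.le_of_lt_succ (Nat.mod_lt _ (Nat.succ_pos q))) hy
    have hmon : (C (bpK c α β p q i j) * (X 0 ^ (i % (p + 1)) * X 1 ^ (j % (q + 1))) : MvPolynomial (Fin 2) ℚ)
        = monomial (Finsupp.single 0 (i % (p + 1)) + Finsupp.single 1 (j % (q + 1))) (bpK c α β p q i j) := by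
      rw [X_pow_eq_monomial, X_pow_eq_monomial, monomial_mul, C_mul_monomial, one_mul, mul_one]
    rw [hmon, coeff_monomial, if_neg]
    intro heq
    rcases hd with h0 | h1
    · have := DFunLike.congr_fun heq 0
      simp at this
      omega
    · have := DFunLike.congr_fun heq 1
      simp at this
      omega

/-- Summand of the reduction map. [folklore] -/
def bpRedFn (c α β : ℚ) (p q : ℕ) (d : Fin 2 →₀ ℕ) (a : ℚ) : MvPolynomial (Fin 2) ℚ := a • bpMonRed c α β p q (d 0) (d 1)

/-- **The Brieskorn–Pham reduction** `bpRed P = Σ p_ij · bpMonRed i j` — linear, supported in the `p × q` box. [folklore] -/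
def bpRed (c α β : ℚ) (p q : ℕ) (P : MvPolynomial (Fin 2) ℚ) : MvPolynomial (Fin 2) ℚ :=
  (AddMonoidAlgebra.coeff P).sum (bpRedFn c α β p q)

/-- Auxiliary step `bpRed_monomial`: bp Red monomial. [bookkeeping] -/
theorem bpRed_monomial (c α β : ℚ) (p q : ℕ) (d : Fin 2 →₀ ℕ) (a : ℚ) :
    bpRed c α β p q (monomial d a) = a • bpMonRed c α β p q (d 0) (d 1) :=
  sum_monomial_eq (by simp [bpRedFn])

/-- Auxiliary step `bpRed_add`: bp Red add. [bookkeeping] -/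
theorem bpRed_add (c α β : ℚ) (p q : ℕ) (P P' : MvPolynomial (Fin 2) ℚ) :
    bpRed c α β p q (P + P') = bpRed c α β p q P + bpRed c α β p q P' := by
  unfold bpRed
  rw [AddMonoidAlgebra.coeff_add]
  exact Finsupp.sum_add_index' (fun d => by simp [bpRedFn]) (fun d b₁ b₂ => by unfold bpRedFn; rw [add_smul])

/-- Auxiliary step `bpRed_smul`: bp Red smul. [bookkeeping] -/
theorem bpRed_smul (c α β : ℚ) (p q : ℕ) (k : ℚ) (P : MvPolynomial (Fin 2) ℚ) :
    bpRed c α β p q (k • P) = k • bpRed c α β p q P := by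
  unfold bpRed
  rw [AddMonoidAlgebra.coeff_smul, Finsupp.sum_smul_index' (fun d => by simp [bpRedFn]), Finsupp.smul_sum]
  apply Finsupp.sum_congr
  intro d _
  unfold bpRedFn
  rw [smul_smul, smul_eq_mul]

/-- Auxiliary step `bpRed_sub`: bp Red sub. [bookkeeping] -/
theorem bpRed_sub (c α β : ℚ) (p q : ℕ) (P P' : MvPolynomial (Fin 2) ℚ) :
    bpRed c α β p q (P - P') = bpRed c α β p q P - bpRed c α β p q P' := by
  rw [sub_eq_add_neg, bpRed_add, ← neg_one_smul ℚ P', bpRed_smul, neg_one_smul, ← sub_eq_add_neg]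

/-- `bpRed` as a linear map. [folklore] -/
def bpRedL (c α β : ℚ) (p q : ℕ) : MvPolynomial (Fin 2) ℚ →ₗ[ℚ] MvPolynomial (Fin 2) ℚ where
  toFun := bpRed c α β p q
  map_add' := bpRed_add c α β p q
  map_smul' k P := by rw [bpRed_smul, RingHom.id_apply]

/-- **Every numerator is congruent to its box reduction**: `P − bpRed P ∈ Ex0 (c + αx^{p+1} + βy^{q+1})` (`α, β ≠ 0`). [folklore] -/
theorem sub_bpRed_mem (c α β : ℚ) (hα : α ≠ 0) (hβ : β ≠ 0) (p q : ℕ) (P : MvPolynomial (Fin 2) ℚ) :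
    P - bpRed c α β p q P ∈ Ex0 (bpQ c α β p q) := by
  induction P using MvPolynomial.induction_on' with
  | monomial d a =>
    rw [bpRed_monomial]
    have hmon : (monomial d a : MvPolynomial (Fin 2) ℚ) = a • (X 0 ^ (d 0) * X 1 ^ (d 1)) := by
      rw [monomial_eq, Finsupp.prod_pow, Fin.prod_univ_two, smul_eq_C_mul]
    rw [hmon, ← smul_sub]
    exact Submodule.smul_mem _ _ (bpMon_sub_red_mem c α β hα hβ p q (d 0) (d 1))
  | add P P' hP hP' =>
    have : P + P' - bpRed c α β p q (P + P') = (P - bpRed c α β p q P) + (P' - bpRed c α β p q P') := by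
      rw [bpRed_add]; ring
    rw [this]
    exact add_mem hP hP'

/-- The reduction is supported in the box `i < p`, `j < q`. [folklore] -/
theorem coeff_bpRed_eq_zero (c α β : ℚ) (p q : ℕ) (P : MvPolynomial (Fin 2) ℚ) (d : Fin 2 →₀ ℕ) (hd : p ≤ d 0 ∨ q ≤ d 1) :
    coeff d (bpRed c α β p q P) = 0 := by
  induction P using MvPolynomial.induction_on' with
  | monomial d' a => rw [bpRed_monomial, coeff_smul, coeff_bpMonRed_eq_zero c α β p q _ _ d hd, smul_zero]
  | add P P' hP hP' => rw [bpRed_add, coeff_add, hP, hP', add_zero]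

/-- `bpRed P = 0` ⟺ its `p·q` box coefficients vanish. [folklore] -/
theorem bpRed_eq_zero_iff (c α β : ℚ) (p q : ℕ) (P : MvPolynomial (Fin 2) ℚ) :
    bpRed c α β p q P = 0 ↔
      ∀ i₀, i₀ < p → ∀ j₀, j₀ < q → coeff (Finsupp.single 0 i₀ + Finsupp.single 1 j₀) (bpRed c α β p q P) = 0 := by
  constructor
  · intro h i₀ _ j₀ _
    rw [h, coeff_zero]
  · intro h
    ext d
    rw [coeff_zero]
    by_cases hb : d 0 < p ∧ d 1 < q
    · have := h (d 0) hb.1 (d 1) hb.2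
      rwa [← finsupp_fin_two_eq d] at this
    · exact coeff_bpRed_eq_zero c α β p q P d (by omega)

/-- **Numerators with vanishing box reduction are exact over `c + αx^{p+1} + βy^{q+1}`.** [folklore] -/
theorem drExact_bp (c α β : ℚ) (hα : α ≠ 0) (hβ : β ≠ 0) (p q : ℕ) (P : MvPolynomial (Fin 2) ℚ)
    (h : bpRed c α β p q P = 0) : DRExact P (bpQ c α β p q) := by
  have := sub_bpRed_mem c α β hα hβ p q P
  rw [h, sub_zero] at this
  exact drExact_of_ex0 this

/-- Coefficient functional. [folklore] -/
def coeffL (d : Fin 2 →₀ ℕ) : MvPolynomial (Fin 2) ℚ →ₗ[ℚ] ℚ where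
  toFun := coeff d
  map_add' := coeff_add d
  map_smul' k P := by rw [coeff_smul, RingHom.id_apply]

/-- **CODIMENSION ≤ p·q (the Milnor number)**: `p·q` explicit `ℚ`-linear functionals whose common kernel consists of exact numerators. [folklore] -/
theorem bp_codim_le (c α β : ℚ) (hα : α ≠ 0) (hβ : β ≠ 0) (p q : ℕ) :
    ∃ Λ : ℕ → ℕ → (MvPolynomial (Fin 2) ℚ →ₗ[ℚ] ℚ),
      ∀ P, (∀ i₀, i₀ < p → ∀ j₀, j₀ < q → Λ i₀ j₀ P = 0) → DRExact P (bpQ c α β p q) := by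
  refine ⟨fun i₀ j₀ => coeffL (Finsupp.single 0 i₀ + Finsupp.single 1 j₀) ∘ₗ bpRedL c α β p q, fun P hP => ?_⟩
  apply drExact_bp c α β hα hβ p q P
  rw [bpRed_eq_zero_iff]
  intro i₀ hi j₀ hj
  exact hP i₀ hi j₀ hj

/-- **DECIDED (m = 2, PROVED, N = 0) — BRIESKORN–PHAM DENOMINATORS `c + αx^{p+1} + βy^{q+1}`, reduction zero:** zero-free on the square, value `0`,
`bpRed P = 0` ⟹ `[ [0,1]², P/Q ] ∈ relations`. Includes the elliptic denominators `1 + x³ + y²` (box `{1, x}`) and the Fermat cubics `1 + x³ + y³`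
(box `{1, x, y, xy}`). [cite: KontsevichZagier2001, §1.2] -/
theorem bp_two_mem_relations (c α β : ℚ) (hα : α ≠ 0) (hβ : β ≠ 0) (p q : ℕ) (r : IntegralRep 2)
    (P : MvPolynomial (Fin 2) ℚ) (hP : bpRed c α β p q P = 0)
    (hd : r.domain = Set.pi Set.univ (fun _ : Fin 2 => Set.Icc (0:ℝ) 1))
    (hQ : ∀ z ∈ Set.pi Set.univ (fun _ : Fin 2 => Set.Icc (0:ℝ) 1), MvPolynomial.aeval z (bpQ c α β p q) ≠ 0)
    (hf : ∀ z ∈ Set.pi Set.univ (fun _ : Fin 2 => Set.Icc (0:ℝ) 1),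
      r.integrand z = MvPolynomial.aeval z P / MvPolynomial.aeval z (bpQ c α β p q))
    (h0 : r.value = 0) : of r ∈ relations := by
  obtain ⟨s, G, hid⟩ := drExact_bp c α β hα hβ p q P hP
  exact mem_relations_of_exact_two r _ _ s G hid hd hQ hf h0

/-- The `p·q`-parameter residual of the Brieskorn–Pham class: numerators with NON-zero box reduction. [folklore] -/
def BPResidual (c α β : ℚ) (p q : ℕ) : Prop :=
  ∀ (r : IntegralRep 2) (P : MvPolynomial (Fin 2) ℚ), bpRed c α β p q P ≠ 0 →
    r.domain = Set.pi Set.univ (fun _ : Fin 2 => Set.Icc (0:ℝ) 1) →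
    (∀ z ∈ Set.pi Set.univ (fun _ : Fin 2 => Set.Icc (0:ℝ) 1), MvPolynomial.aeval z (bpQ c α β p q) ≠ 0) →
    (∀ z ∈ Set.pi Set.univ (fun _ : Fin 2 => Set.Icc (0:ℝ) 1),
      r.integrand z = MvPolynomial.aeval z P / MvPolynomial.aeval z (bpQ c α β p q)) →
    r.value = 0 → ∃ N : ℕ, (fun y : FormalRep => of piRep * y)^[N] (of r) ∈ relations

/-- **26322 on a Brieskorn–Pham denominator ⟸ its `p·q`-parameter residual (PROVED split).** [folklore] -/
theorem bp_single_of_residual (c α β : ℚ) (hα : α ≠ 0) (hβ : β ≠ 0) (p q : ℕ) (hres : BPResidual c α β p q)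
    (r : IntegralRep 2) (P : MvPolynomial (Fin 2) ℚ)
    (hd : r.domain = Set.pi Set.univ (fun _ : Fin 2 => Set.Icc (0:ℝ) 1))
    (hQ : ∀ z ∈ Set.pi Set.univ (fun _ : Fin 2 => Set.Icc (0:ℝ) 1), MvPolynomial.aeval z (bpQ c α β p q) ≠ 0)
    (hf : ∀ z ∈ Set.pi Set.univ (fun _ : Fin 2 => Set.Icc (0:ℝ) 1),
      r.integrand z = MvPolynomial.aeval z P / MvPolynomial.aeval z (bpQ c α β p q))
    (h0 : r.value = 0) : ∃ N : ℕ, (fun y : FormalRep => of piRep * y)^[N] (of r) ∈ relations := by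
  by_cases hP : bpRed c α β p q P = 0
  · exact ⟨0, by simpa using bp_two_mem_relations c α β hα hβ p q r P hP hd hQ hf h0⟩
  · exact hres r P hP hd hQ hf h0

/-! ### §15b Examples (kernel-checked): the elliptic denominator `1 + x³ + y²` and the Fermat cubic `1 + x³ + y³` -/

example : bpQ 1 1 1 2 1 = (1 + X 0 ^ 3 + X 1 ^ 2 : MvPolynomial (Fin 2) ℚ) := by simp [bpQ]

/-- Over `1 + x³ + y²`: `y² ↦ −3/5` (`2y² ≡ 3x³`, `1 + x³ + y² ≡ 0`). -/
example : bpMonRed 1 1 1 2 1 0 2 = (C (-3/5 : ℚ) : MvPolynomial (Fin 2) ℚ) := by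
  simp [bpMonRed, bpK, kx, ky, bpS]
  norm_num

/-- Over `1 + x³ + y²`: the box monomial `x` is its own reduction, the edge monomial `x²` reduces to `0`. -/
example : bpMonRed 1 1 1 2 1 1 0 = (X 0 : MvPolynomial (Fin 2) ℚ) := by
  simp [bpMonRed, bpK, kx, ky]

example : bpMonRed 1 1 1 2 1 2 0 = (0 : MvPolynomial (Fin 2) ℚ) := by
  simp [bpMonRed]

end Summit.KontsevichZagierPeriods.RootDecompRationalCubeDichotomy.Rung26322.RankDescent
end
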